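import Summits.PneNP.PneNP.Theorems.SoloBlindAnchor
import Literature.Computability.MetaComplexity.ProofSystemsProofs
import Literature.Computability.MetaComplexity.OnesZeroPadRefuters
import Literature.Computability.Complexity.TautMachine
import Literature.Computability.Complexity.CookLevinReduction
import Literature.Computability.Complexity.CircuitClassesUniformProofs
import Literature.Computability.Complexity.ExpCollapseOfPEqNP
import Literature.Computability.Complexity.NegCNFTranscoder
import Literature.Computability.Complexity.NPClosureProofs
import Literature.Computability.FineGrained.SatAlgorithmsProofs
import HarnessLib

/-!
# The corridor map: every classical sufficient hypothesis, and the two equivalent forms, wired to the summit constant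

Companion of the report "What a proof of `P ≠ NP` must do, and where every known approach
breaks" (solo-blind).  Nothing here is new mathematics; the point is that each corridor's
HYPOTHESIS is a typed statement of the tree and its BRIDGE to the audited constant
`Summit.PneNP.PneNP` is kernel-checked, so that "where the approach breaks" can be located at a
named declaration.  All bridges below are assembled from PROVED tree theorems (no named fact is
assumed):

* §A proof complexity — `pneNP_of_NP_ne_coNP : NP ≠ coNP → PneNP` (closure of `P` under
  complement, `co_P_holds`); `NP_ne_coNP_iff_TAUT_not_mem_NP`; and Cook–Reckhow
  (`hasPolyBoundedProofSystem_iff_mem_NP_holds`, `TAUT_mem_coNP_holds`, `CookLevin.isHard_coNP_TAUT_holds`):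
  `NP_ne_coNP_iff_not_hasPolyBoundedProofSystem_TAUT : NP ≠ coNP ↔ ¬ HasPolyBoundedProofSystem TAUT`,
  whence `pneNP_of_not_hasPolyBoundedProofSystem_TAUT`.
* §C circuits — `pneNP_of_SAT_not_mem_PPoly : SAT ∉ P/poly → PneNP` and
  `pneNP_of_not_NP_subset_PPoly` (`P_subset_PPoly_holds`).
* §D uniform / fine-grained — `pneNP_of_ETH : ETH → PneNP` (`P_ne_NP_of_eth_holds`),
  `pneNP_of_EXP_ne_NEXP : EXP ≠ NEXP → PneNP` (`P_ne_NP_of_EXP_ne_NEXP`, padding).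
* §F refuters — `pneNP_iff_SAT_refuters : PneNP ↔ ∀ D ∈ P, ∃ R, …` (Gutfreund–Shaltiel–Ta-Shma /
  Chen–Jin–Santhanam–Williams Thm 1.2, tree `not_NP_subset_P_iff_refuters` at `SAT`): the summit
  is EQUIVALENT to the existence, against every polynomial-time heuristic, of a polynomial-time
  generator of instances on which it errs infinitely often.
* §B streaming magnification is `SoloBlindUniformMagnification` / `SoloBlindStreamingCalibration`
  (`pneNP_of_streamingLowerBound`, the sandwich) and the summit's own streaming form is THEOREM E
  (`pneNP_iff_SAT_not_mem_USTREAM`); they are not re-derived here.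

References: S. A. Cook, R. A. Reckhow, J. Symb. Logic 44 (1979), Prop. 1.4 and Cor.;
R. M. Karp, R. J. Lipton, STOC 1980 (P ⊆ P/poly, folklore direction); R. Impagliazzo, R. Paturi,
JCSS 62 (2001) §1 (ETH); folklore padding (`EXP ≠ NEXP → P ≠ NP`, Arora–Barak 2009, Thm. 2.22);
D. Gutfreund, R. Shaltiel, A. Ta-Shma, Comput. Complexity 16 (2007), Thm. 1.1;
L. Chen, C. Jin, R. Santhanam, R. Williams, FOCS 2021, Thm. 1.2.
-/

namespace Summit.PneNP.PneNP.Theorems.SoloBlind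

open Computability Filter
open Literature.Computability.Complexity Literature.Computability.MetaComplexity
open Literature.Computability.FineGrained

/-! ### §A: proof complexity -/

/-- `P = NP` forces `NP = coNP` (closure of `P` under complement). [folklore; cite: AroraBarak2009, §2.6] -/
theorem NP_eq_coNP_of_P_eq_NP (h : Classes.P = Nondeterministic.NP) : Nondeterministic.NP = coNP := by
  rw [coNP, ← h]
  exact co_P_holds.symm

/-- **§A bridge**: `NP ≠ coNP → PneNP`. [folklore; cite: AroraBarak2009, §2.6] -/
theorem pneNP_of_NP_ne_coNP (h : Nondeterministic.NP ≠ coNP) : PneNP :=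
  pneNP_iff_P_ne_NP.2 fun hP => h (NP_eq_coNP_of_P_eq_NP hP)

/-- `NP ≠ coNP` iff the `coNP`-complete language `TAUT` is outside `NP` (Cook–Levin for `TAUT`,
closure of `NP` under Karp reductions). [cite: CookReckhow1979, §1 (Cor. of Prop. 1.4)] -/
theorem NP_ne_coNP_iff_TAUT_not_mem_NP : Nondeterministic.NP ≠ coNP ↔ TAUT ∉ Nondeterministic.NP := by
  constructor
  · intro hne hT
    apply hne
    -- `coNP ⊆ NP` by hardness of `TAUT`, and then `NP ⊆ coNP` by complementation
    have hco : coNP ⊆ Nondeterministic.NP := fun L hL =>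
      mem_NP_of_karpReducible_holds (CookLevin.isHard_coNP_TAUT_holds L hL) hT
    apply Set.Subset.antisymm _ hco
    intro L hL
    have h1 : Lᶜ ∈ coNP := by
      show Lᶜᶜ ∈ Nondeterministic.NP
      rw [compl_compl]; exact hL
    have h2 : Lᶜ ∈ Nondeterministic.NP := hco h1
    exact h2
  · intro hT heq
    exact hT (heq ▸ TAUT_mem_coNP_holds)

/-- **Cook–Reckhow, summit-facing form**: `NP ≠ coNP ↔ TAUT has no polynomially bounded proof
system`. [cite: CookReckhow1979, Prop. 1.4 and Cor.] -/
theorem NP_ne_coNP_iff_not_hasPolyBoundedProofSystem_TAUT :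
    Nondeterministic.NP ≠ coNP ↔ ¬ HasPolyBoundedProofSystem TAUT := by
  have hCR : HasPolyBoundedProofSystem TAUT ↔ TAUT ∈ Nondeterministic.NP :=
    hasPolyBoundedProofSystem_iff_mem_NP_holds (L := TAUT)
  rw [NP_ne_coNP_iff_TAUT_not_mem_NP, hCR]

/-- **§A bridge, Cook–Reckhow form**: super-polynomial lower bounds for EVERY propositional proof
system for `TAUT` imply the summit. (The converse is not claimed: `P ≠ NP` does not give
`NP ≠ coNP`.) [cite: CookReckhow1979, §1] -/
theorem pneNP_of_not_hasPolyBoundedProofSystem_TAUT (h : ¬ HasPolyBoundedProofSystem TAUT) : PneNP :=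
  pneNP_of_NP_ne_coNP (NP_ne_coNP_iff_not_hasPolyBoundedProofSystem_TAUT.2 h)

/-! ### §C: Boolean circuits -/

/-- **§C bridge**: `SAT ∉ P/poly → PneNP` (since `P ⊆ P/poly`). [folklore; cite: AroraBarak2009, §6.1] -/
theorem pneNP_of_SAT_not_mem_PPoly (h : SAT ∉ PPoly) : PneNP :=
  pneNP_of_SAT_not_mem_P fun hP => h (P_subset_PPoly_holds hP)

/-- **§C bridge, class form**: `NP ⊄ P/poly → PneNP`. [folklore; cite: AroraBarak2009, §6.1] -/
theorem pneNP_of_not_NP_subset_PPoly (h : ¬ Nondeterministic.NP ⊆ PPoly) : PneNP :=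
  pneNP_iff_P_ne_NP.2 fun hP => h (hP ▸ P_subset_PPoly_holds)

/-! ### §D: uniform / fine-grained hypotheses -/

/-- **§D bridge**: the Exponential Time Hypothesis implies the summit. [cite: ImpagliazzoPaturi2001, §1] -/
theorem pneNP_of_ETH (h : ETH) : PneNP :=
  pneNP_iff_P_ne_NP.2 (P_ne_NP_of_eth_holds h)

/-- **§D bridge**: `EXP ≠ NEXP → PneNP` (padding). [folklore; cite: AroraBarak2009, Thm. 2.22] -/
theorem pneNP_of_EXP_ne_NEXP (h : EXP ≠ NEXP) : PneNP :=
  pneNP_iff_P_ne_NP.2 (P_ne_NP_of_EXP_ne_NEXP h)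

/-! ### §F: the refuter form of the summit -/

/-- **§F: the summit is equivalent to its constructive form.** `PneNP` iff every polynomial-time
heuristic `D` for `SAT` is refuted infinitely often by a polynomial-time instance generator
`R : 1ⁿ ↦ R n` with `|R n| ≤ n` (`R n ∈ SAT ∆ D` for infinitely many `n`).
[cite: GutfreundShaltielTashma2007, Thm. 1.1] [cite: ChenEtAl2022, Thm. 1.2] -/
theorem pneNP_iff_SAT_refuters :
    PneNP ↔ ∀ D ∈ Classes.P, ∃ R : ℕ → List Bool,
      PolyTimeComputable unaryEncodeNat (id : List Bool → List Bool) R ∧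
        (∀ n, (R n).length ≤ n) ∧ ∃ᶠ n in atTop, (R n ∈ SAT ↔ R n ∉ D) := by
  rw [← not_NP_subset_P_iff_refuters isNPComplete_SAT_holds, pneNP_iff_P_ne_NP]
  constructor
  · intro hne hsub
    exact hne (Set.Subset.antisymm P_subset_NP_holds hsub)
  · intro hns heq
    exact hns (heq ▸ subset_rfl)

end Summit.PneNP.PneNP.Theorems.SoloBlind
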